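import Summits.BirchSwinnertonDyer.BirchSwinnertonDyer.Theorems.UniversalToricDescentSigmaLocalSurjective
import Summits.BirchSwinnertonDyer.BirchSwinnertonDyer.Theorems.UniversalToricDescentRelaxedCoinvariantsAnyTorsion
import HarnessLib

/-!
# Route UniversalToricDescent — Greenberg–Vatsal Prop. 2.1 AT THE STRICT PLACE, without (iv):
# the signature map `G_rel^Σ(K_∞, E[p^∞]) → ⊕_{w∣𝔭} H¹(K_{∞,w}, E[p^∞])` is ONTO

Lead prover bsd-wall-utd-p1 g13 (`--supports` ♭T′ stmt-BirchSwinnertonDyer-26975; step (β2) of the (L)-free residual comparison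
(M1) of stub B′ `stub_lambdaTransportPT`, memo RESIDUE-B-PRIME-utdp1g13 §3). For the count of `#Sel_𝔭^Σ(K_∞, E[p^∞])[p]` without
the local hypothesis (L) `E[p]^{G_{K_{∞,𝔭}}} = 0` one needs that the classes of `H¹(K_∞, E[p^∞])` with the away conditions off `Σ`
and NO condition above `p` — the group `G_rel^Σ = selmerAc W p κ v₀ Σ` of `…RelaxedCoinvariantsAnyTorsion` (fake strict place `v₀ ∤ p`,
`v₀ ∉ Σ`) — realise EVERY right-`ker κ`-invariant, left-`D_𝔭`-equivariant function `Γ_K → H¹(H ∩ D_𝔭, E[p^∞])`, i.e. every element of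
`⊕_{w∣𝔭} H¹(K_{∞,w}, E[p^∞])` (`𝔭 ∣ p` finitely decomposed), as a signature `σ ↦ res_{H∩D_𝔭}(conj_σ s)`; the kernel is `Sel_𝔭^Σ`.
This is the anticyclotomic/BDP case of Greenberg–Vatsal's Prop. 2.1 at the prime above `p`, from BASE data only: Poitou–Tate for
`K`, Milne I 2.8, a killing exponent at the conjugate prime `𝔮`, `Sel_𝔮(K, E[p^∞])` finite, `H²(K, E[p^∞]) = 0`.

* `exists_mem_selmerAc_relaxed_forall_resKerD_strictPlace_eq_anyTorsion` — proof = g8's engine (`…SigmaLocalSurjective[AnyTorsion]`)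
  run at `v := 𝔭`: `φ = conj_γ − 1` onto `G_rel^Σ` (`surjective_conjSelmerAc_sub_one_relaxed_anyTorsion`), `ψ = R_γ − 1` locally
  nilpotent, `ker ψ ⊆ im` by procyclic descent on `D_𝔭` and Poitou–Tate surgery prescribing the descended class AT `𝔭`
  (`levelLiftingP_of_finite_anyTorsion` with no away place; the lifted class is away-trivial everywhere and unconstrained at `𝔮`).
* `exists_mem_selmerAc_relaxed_forall_resKerD_strictPlace_eq_baseChange_anyTorsion` — the route's instance (`E/ℚ`, `K` imaginary
  quadratic with `p` split, Poitou–Tate ×2, `Sel_v(K, E[p^∞]) < ∞` at both `v ∣ p`).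

HONEST STATUS: helper theorems, CONDITIONAL on the cited Poitou–Tate facts; the COUNT (M1 from this surjectivity for both curves +
local tower torsion finiteness) is the sequel. THEOREMS ONLY; no definition, no named fact, no `sorry`. BSD is not advanced by this file.
References: [GreenbergVatsal2000] §2 Prop. (2.1), Cor. (2.3) (pp. 23–25); [JetchevSkinnerWan2017] Prop. 3.3.2, Lemma 3.3.3
(arXiv:1512.06894 pp. 11–12); [Washington1997] §13.1.
-/

set_option autoImplicit false
-- `…BirchSwinnertonDyer.BirchSwinnertonDyer.Theorems…` is the problem's mandated namespace (D-0017).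
set_option linter.dupNamespace false

noncomputable section

open scoped Classical

namespace Summit.BirchSwinnertonDyer.BirchSwinnertonDyer.Theorems.UniversalToricDescentSigmaLocalImage

open CategoryTheory Function Field NumberField IsDedekindDomain WeierstrassCurve
open Literature.NumberTheory.GaloisRepresentations Literature.NumberTheory.EllipticCurves
  Literature.NumberTheory.EllipticCurves.GreenbergSelmer Literature.NumberTheory.GaloisCohomology
  Literature.NumberTheory.EllipticCurves.Rank1Residual
  Summit.BirchSwinnertonDyer.Rank1Residual Summit.BirchSwinnertonDyer.Rank1Residual.X11b
  Summit.BirchSwinnertonDyer.Rank1Residual.X11b.Coinv Summit.BirchSwinnertonDyer.Rank1Residual.X11b.LocBridge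
  Summit.BirchSwinnertonDyer.Rank1Residual.X11b.AcSelmer Summit.BirchSwinnertonDyer.Rank1Residual.X11b.H2Support
  Summit.BirchSwinnertonDyer.Rank1Residual.X11b.Levels
  Summit.BirchSwinnertonDyer.BirchSwinnertonDyer.Theorems.UniversalToricDescentSigmaCoinvariants
  Summit.BirchSwinnertonDyer.BirchSwinnertonDyer.Theorems.UniversalToricDescentSigmaLocalStabilizer
open Summit.BirchSwinnertonDyer.Rank1Residual.X11b.ProcyclicDescent (kerK)

variable {K : Type} [Field K] [NumberField K] (W : WeierstrassCurve K) [W.IsElliptic] (p : ℕ)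
  [Fact p.Prime] (κ : ZpExtension K p)

set_option maxHeartbeats 400000 in
/-- **`G_rel^Σ(K_∞, E[p^∞]) ↠ ⊕_{w∣𝔭} H¹(K_{∞,w}, E[p^∞])` at the strict place `𝔭 ∣ p`, WITHOUT (iv)** (Greenberg–Vatsal
Prop. 2.1, anticyclotomic/BDP shape). Hypotheses: `K` totally complex; Poitou–Tate; Milne I 2.8; `𝔭 ≠ 𝔮` above `p`; a killing exponent
at `𝔮`; `Sel_𝔮(K, E[p^∞])` finite; `H²(K, E[p^∞]) = 0`; `γ` a topological generator; `Σ` and a fake strict place `v₀ ∤ p`, `v₀ ∉ Σ`;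
`𝔭` finitely decomposed in `K_∞`. Every right-`ker κ`-invariant, left-`D_𝔭`-equivariant `F : Γ_K → H¹(H ∩ D_𝔭, E[p^∞])` is the
signature at `𝔭` of some `s ∈ selmerAc W p κ v₀ Σ`. [cite: GreenbergVatsal2000, §2 Prop. (2.1) and Cor. (2.3) (pp. 23–25)]
[cite: JetchevSkinnerWan2017, Prop. 3.3.2 and Lemma 3.3.3 (arXiv:1512.06894 pp. 11–12)] -/
theorem exists_mem_selmerAc_relaxed_forall_resKerD_strictPlace_eq_anyTorsion [IsTotallyComplex K]
    (hPT : poitouTate_selmerStructure_duality K)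
    (hEP : ∀ v : HeightOneSpectrum (𝓞 K), localEulerPoincareCharacteristic (v.adicCompletion K))
    {𝔭 𝔮 : HeightOneSpectrum (𝓞 K)} (h𝔭 : ((p : ℕ) : 𝓞 K) ∈ 𝔭.asIdeal)
    (h𝔮 : ((p : ℕ) : 𝓞 K) ∈ 𝔮.asIdeal) (hne : 𝔮 ≠ 𝔭)
    {m : ℕ} (htor𝔮 : ∀ Q : W.geomPrimaryTorsion p, (∀ d ∈ decomp 𝔮, d • Q = Q) → p ^ m • Q = 0)
    (hfin : Finite (selmerAcBase W p 𝔮 ∅))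
    (h2 : Subsingleton (galoisCohomology (primaryGaloisModule W p) 2))
    {γ : absoluteGaloisGroup K} (hγ : κ.IsTopGenerator γ) (S : Set (HeightOneSpectrum (𝓞 K)))
    {v₀ : HeightOneSpectrum (𝓞 K)} (hv₀ : ((p : ℕ) : 𝓞 K) ∉ v₀.asIdeal) (hv₀S : v₀ ∉ S)
    (hv : ¬ (decomp 𝔭 ≤ κ.kerSubgroup))
    (F : absoluteGaloisGroup K → subgroupH1 (kerD κ 𝔭) (W.geomPrimaryTorsion p))
    (hFH : ∀ (σ h : absoluteGaloisGroup K), h ∈ κ.kerSubgroup → F (σ * h) = F σ)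
    (hFD : ∀ (d : decomp (K := K) 𝔭) (σ : absoluteGaloisGroup K),
      F ((d : absoluteGaloisGroup K) * σ) = conjH1 (kerD κ 𝔭) (W.geomPrimaryTorsion p) d (F σ)) :
    ∃ s ∈ selmerAc W p κ v₀ S, ∀ σ : absoluteGaloisGroup K,
      resKerD κ (W.geomPrimaryTorsion p) 𝔭 (W.conjH1 p κ.kerSubgroup σ s) = F σ := by
  have hpr : p.Prime := Fact.out
  haveI : CompactSpace (absoluteGaloisGroup K) := absoluteGaloisGroup_compactSpace K
  haveI : CompactSpace (decomp (K := K) 𝔭) :=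
    isCompact_iff_compactSpace.mp (Coinv.isClosed_decomp 𝔭).isCompact
  have hγ' : κ γ = Multiplicative.ofAdd 1 := hγ
  -- notation
  set H := κ.kerSubgroup with hH
  have hM : ∀ m : W.geomPrimaryTorsion p, IsOpen {σ : absoluteGaloisGroup K | σ • m = m} :=
    isOpen_stabilizer_geomPrimaryTorsion W p
  have htor : IsPrimaryTorsion p (W.geomPrimaryTorsion p) := isPrimaryTorsion_geomPrimaryTorsion W p
  have hA : ∀ a : W.geomPrimaryTorsion p, IsOpen {d : decomp (K := K) 𝔭 | d • a = a} := fun a ↦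
    (hM a).preimage continuous_subtype_val
  -- the exact index `κ(D_v) = p^c ℤ_p`
  obtain ⟨c, -, hc, hle⟩ := exists_pow_and_forall_dvd_of_not_le κ 𝔭 hv
  -- moving an element of `H` to the right: `x h y ∈ x y H`
  have hmoveH : ∀ (x y h : absoluteGaloisGroup K), h ∈ H → ∃ h' ∈ H, x * h * y = x * y * h' :=
    fun x y h hh ↦ ⟨y⁻¹ * h * y, Subgroup.Normal.conj_mem' inferInstance h hh y, by group⟩
  -- the target: right-`H`-invariant, left-`D_v`-equivariant functions
  let P : AddSubgroup (absoluteGaloisGroup K → subgroupH1 (kerD κ 𝔭) (W.geomPrimaryTorsion p)) :=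
    { carrier := {G | (∀ (σ h : absoluteGaloisGroup K), h ∈ H → G (σ * h) = G σ) ∧
        ∀ (d : decomp (K := K) 𝔭) (σ : absoluteGaloisGroup K),
          G ((d : absoluteGaloisGroup K) * σ) = conjH1 (kerD κ 𝔭) (W.geomPrimaryTorsion p) d (G σ)}
      zero_mem' := ⟨fun _ _ _ ↦ rfl, fun d σ ↦ by simp only [Pi.zero_apply, map_zero]⟩
      add_mem' := fun {a b} ha hb ↦ ⟨fun σ h hh ↦ by simp only [Pi.add_apply, ha.1 σ h hh, hb.1 σ h hh],
        fun d σ ↦ by simp only [Pi.add_apply, ha.2 d σ, hb.2 d σ, map_add]⟩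
      neg_mem' := fun {a} ha ↦ ⟨fun σ h hh ↦ by simp only [Pi.neg_apply, ha.1 σ h hh],
        fun d σ ↦ by simp only [Pi.neg_apply, ha.2 d σ, map_neg]⟩ }
  -- a member of `P` evaluated at `d x h`
  have hPeval : ∀ G : P, ∀ (d : decomp (K := K) 𝔭) (x h : absoluteGaloisGroup K), h ∈ H →
      G.1 ((d : absoluteGaloisGroup K) * x * h) =
        conjH1 (kerD κ 𝔭) (W.geomPrimaryTorsion p) d (G.1 x) := by
    intro G d x h hh
    rw [mul_assoc, G.2.2 d, G.2.1 x h hh]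
  -- the signature map `Φ : Sel^{Σ∪{v}} → P`
  have hΦmem : ∀ x : W.subgroupH1 p H,
      (fun σ ↦ resKerD κ (W.geomPrimaryTorsion p) 𝔭 (W.conjH1 p H σ x)) ∈ P := by
    intro x
    refine ⟨fun σ h hh ↦ ?_, fun d σ ↦ ?_⟩
    · simp only
      rw [W.conjH1_mul_holds p H, AddMonoidHom.comp_apply, W.conjH1_of_mem_holds p H hh,
        AddMonoidHom.id_apply]
    · simp only
      rw [W.conjH1_mul_holds p H, AddMonoidHom.comp_apply, resKerD_conjH1]
  let Φ : selmerAc W p κ v₀ S →+ P :=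
    { toFun := fun s ↦ ⟨fun σ ↦ resKerD κ (W.geomPrimaryTorsion p) 𝔭 (W.conjH1 p H σ s), hΦmem s⟩
      map_zero' := Subtype.ext (funext fun σ ↦ by simp)
      map_add' := fun a b ↦ Subtype.ext (funext fun σ ↦ by simp) }
  have hΦapply : ∀ (s : selmerAc W p κ v₀ S) (σ : absoluteGaloisGroup K),
      (Φ s).1 σ = resKerD κ (W.geomPrimaryTorsion p) 𝔭 (W.conjH1 p H σ s) := fun _ _ ↦ rfl
  -- `R_γ` on `P` and `ψ = R_γ - 1`
  have hRmem : ∀ G : P, (fun σ ↦ G.1 (σ * γ)) ∈ P := by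
    intro G
    refine ⟨fun σ h hh ↦ ?_, fun d σ ↦ ?_⟩
    · simp only
      obtain ⟨h', hh', e⟩ := hmoveH σ γ h hh
      rw [e, G.2.1 _ h' hh']
    · simp only
      rw [mul_assoc, G.2.2 d]
  let R : AddMonoid.End P :=
    { toFun := fun G ↦ ⟨fun σ ↦ G.1 (σ * γ), hRmem G⟩
      map_zero' := Subtype.ext (funext fun _ ↦ rfl)
      map_add' := fun _ _ ↦ Subtype.ext (funext fun _ ↦ rfl) }
  have hRapply : ∀ (G : P) (σ : absoluteGaloisGroup K), (R G).1 σ = G.1 (σ * γ) := fun _ _ ↦ rfl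
  have hRpow : ∀ (n : ℕ) (G : P) (σ : absoluteGaloisGroup K), ((R ^ n) G).1 σ = G.1 (σ * γ ^ n) := by
    intro n
    induction n with
    | zero => intro G σ; rw [pow_zero, pow_zero, mul_one, AddMonoid.End.one_apply]
    | succ n ih =>
      intro G σ
      rw [pow_succ, AddMonoid.End.coe_mul, Function.comp_apply, ih, hRapply, pow_succ, mul_assoc]
  obtain ⟨ψ, hψ⟩ : ∃ ψ : AddMonoid.End P, ψ = R - 1 := ⟨_, rfl⟩
  have hψapply : ∀ (G : P) (σ : absoluteGaloisGroup K), (ψ G).1 σ = G.1 (σ * γ) - G.1 σ :=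
    fun _ _ ↦ by rw [hψ]; rfl
  -- (a) `φ = conj_γ - 1` is onto `Sel^{Σ∪{v}}`
  have hφ := surjective_conjSelmerAc_sub_one_relaxed_anyTorsion W p κ hPT hEP h𝔭 h𝔮 hne htor𝔮 hfin
    h2 hγ S hv₀ hv₀S
  -- the commutation `Φ ∘ φ = ψ ∘ Φ`
  have hcomm : ∀ s : selmerAc W p κ v₀ S,
      Φ ((conjSelmerAc W p κ v₀ S γ - 1 : AddMonoid.End _) s) = ψ (Φ s) := by
    intro s
    apply Subtype.ext
    funext σ
    rw [hΦapply, hψapply, hΦapply, hΦapply, IwasawaDual.End_sub_apply, AddMonoid.End.one_apply,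
      AddSubgroupClass.coe_sub, coe_conjSelmerAc_apply, map_sub, map_sub, W.conjH1_mul_holds p H,
      AddMonoidHom.comp_apply]
  -- (c) `ψ` is locally nilpotent on `P`
  have hnil : ∀ G : P, ∃ N : ℕ, (ψ ^ N) G = 0 := by
    intro G
    -- one `t`, `k` for the finitely many values `G(γ^i)`, `i < p^c`
    obtain ⟨t, k, htk⟩ := exists_forall_dvd_imp_conjH1_kerD_eq_finset κ hM htor 𝔭 hc
      ((Finset.range (p ^ c)).image fun i ↦ G.1 (γ ^ i))
    have hval : ∀ σ : absoluteGaloisGroup K, p ^ k • G.1 σ = 0 ∧ ∀ d' : decomp (K := K) 𝔭,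
        (p : ℤ_[p]) ^ t ∣ (κ (d' : absoluteGaloisGroup K)).toAdd →
        conjH1 (kerD κ 𝔭) (W.geomPrimaryTorsion p) d' (G.1 σ) = G.1 σ := by
      intro σ
      obtain ⟨d, n, h, hn, hh, rfl⟩ := exists_decomp_mul_pow_lt_mul_mem_ker κ hγ 𝔭 hc σ
      have hmem : G.1 (γ ^ n) ∈ (Finset.range (p ^ c)).image fun i ↦ G.1 (γ ^ i) :=
        Finset.mem_image.mpr ⟨n, Finset.mem_range.mpr hn, rfl⟩
      obtain ⟨hk, ht⟩ := htk _ hmem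
      rw [hPeval G d (γ ^ n) h hh]
      refine ⟨by rw [← map_nsmul, hk, map_zero], fun d' hd' ↦ ?_⟩
      have e : d' * d = d * (d⁻¹ * d' * d) := by group
      have hκ' : (κ ((d⁻¹ * d' * d : decomp (K := K) 𝔭) : absoluteGaloisGroup K)).toAdd =
          (κ (d' : absoluteGaloisGroup K)).toAdd := by
        simp only [Subgroup.coe_mul, Subgroup.coe_inv, map_mul, map_inv, toAdd_mul, toAdd_inv]
        abel
      rw [← AddMonoidHom.comp_apply, ← conjH1_mul_holds (kerD κ 𝔭), e,
        conjH1_mul_holds (kerD κ 𝔭), AddMonoidHom.comp_apply, ht _ (by rw [hκ']; exact hd')]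
    -- `γ^{p^{c+t}} = d_N h_N` with `p^t ∣ κ d_N`
    obtain ⟨dN, hdN⟩ := hc ((p : ℤ_[p]) ^ t)
    have hhN : ((dN : absoluteGaloisGroup K))⁻¹ * γ ^ p ^ (c + t) ∈ H := by
      rw [hH, ZpExtension.mem_kerSubgroup, map_mul, map_inv, map_pow, hγ', ← ofAdd_nsmul]
      apply Multiplicative.toAdd.injective
      rw [toAdd_mul, toAdd_inv, toAdd_ofAdd, toAdd_one, hdN, nsmul_eq_mul, mul_one, Nat.cast_pow,
        pow_add, neg_add_cancel]
    have hRN : (R ^ p ^ (c + t)) G = G := by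
      apply Subtype.ext
      funext σ
      rw [hRpow]
      obtain ⟨d, n, h, -, hh, rfl⟩ := exists_decomp_mul_pow_lt_mul_mem_ker κ hγ 𝔭 hc σ
      obtain ⟨h', hh', e1⟩ := hmoveH ((d : absoluteGaloisGroup K) * γ ^ n) (γ ^ p ^ (c + t)) h hh
      obtain ⟨h'', hh'', e3⟩ := hmoveH ((d : absoluteGaloisGroup K) * dN) (γ ^ n)
        (((dN : absoluteGaloisGroup K))⁻¹ * γ ^ p ^ (c + t)) hhN
      have e2 : (d : absoluteGaloisGroup K) * γ ^ n * γ ^ p ^ (c + t) * h' =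
          (d : absoluteGaloisGroup K) * dN * (((dN : absoluteGaloisGroup K))⁻¹ * γ ^ p ^ (c + t)) *
            γ ^ n * h' := by
        group
      rw [e1, e2, e3, mul_assoc _ h'' h', G.2.1 _ _ (H.mul_mem hh'' hh'), ← Subgroup.coe_mul,
        G.2.2 (d * dN) (γ ^ n), conjH1_mul_holds (kerD κ 𝔭), AddMonoidHom.comp_apply,
        (hval (γ ^ n)).2 dN ⟨(p : ℤ_[p]) ^ c, by rw [hdN, mul_comm]⟩, hPeval G d (γ ^ n) h hh]
    have hkG : p ^ k • G = 0 :=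
      Subtype.ext (funext fun σ ↦ show p ^ k • G.1 σ = 0 from (hval σ).1)
    exact ⟨k * p ^ (c + t), hψ ▸ IwasawaDual.pow_mul_prime_pow_apply_eq_zero hpr R (c + t) hRN hkG⟩
  -- (b) `ker ψ ⊆ im Φ`
  have hker : ∀ G : P, ψ G = 0 → G ∈ Φ.range := by
    intro G hG
    have hper : ∀ σ : absoluteGaloisGroup K, G.1 (σ * γ) = G.1 σ := fun σ ↦ by
      have h := congrArg (fun X : P ↦ X.1 σ) hG
      simp only [hψapply] at h
      exact sub_eq_zero.mp h
    obtain ⟨f, hf⟩ : ∃ f : subgroupH1 (kerD κ 𝔭) (W.geomPrimaryTorsion p), G.1 1 = f := ⟨_, rfl⟩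
    -- `G(γ^n) = f`
    have hpow : ∀ n : ℕ, G.1 (γ ^ n) = f := by
      intro n
      induction n with
      | zero => rw [pow_zero, hf]
      | succ n ih => rw [pow_succ, hper, ih]
    -- `f` is fixed by every `d ∈ D_v`
    obtain ⟨t, ht⟩ := exists_forall_dvd_imp_conjH1_kerD_eq κ hM 𝔭 hc f
    have hfix : ∀ d : decomp (K := K) 𝔭, conjH1 (kerD κ 𝔭) (W.geomPrimaryTorsion p) d f = f := by
      intro d
      -- `κ d = p^c z`, `z = n + p^t w`: `d = d₂ · e` with `κ d₂ = p^c p^t w`, `κ e = p^c n`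
      obtain ⟨z, hz⟩ := hle d
      obtain ⟨w, hw⟩ := Ideal.mem_span_singleton.mp (PadicInt.appr_spec t z)
      obtain ⟨d₂, hd₂⟩ := hc ((p : ℤ_[p]) ^ t * w)
      have hκe : (κ ((d₂⁻¹ * d : decomp (K := K) 𝔭) : absoluteGaloisGroup K)).toAdd =
          (p : ℤ_[p]) ^ c * (z.appr t : ℕ) := by
        rw [Subgroup.coe_mul, Subgroup.coe_inv, map_mul, map_inv, toAdd_mul, toAdd_inv, hd₂, hz]
        linear_combination (p : ℤ_[p]) ^ c * hw
      have hh₀ : (((d₂⁻¹ * d : decomp (K := K) 𝔭) : absoluteGaloisGroup K))⁻¹ *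
          γ ^ (p ^ c * z.appr t) ∈ H := by
        rw [hH, ZpExtension.mem_kerSubgroup, map_mul, map_inv, map_pow, hγ', ← ofAdd_nsmul]
        apply Multiplicative.toAdd.injective
        rw [toAdd_mul, toAdd_inv, toAdd_ofAdd, toAdd_one, hκe, nsmul_eq_mul, mul_one, Nat.cast_mul,
          Nat.cast_pow, neg_add_cancel]
      have h1 : conjH1 (kerD κ 𝔭) (W.geomPrimaryTorsion p) (d₂⁻¹ * d) f = f := by
        have h := hpow (p ^ c * z.appr t)
        rw [show γ ^ (p ^ c * z.appr t) = ((d₂⁻¹ * d : decomp (K := K) 𝔭) : absoluteGaloisGroup K) *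
            1 * ((((d₂⁻¹ * d : decomp (K := K) 𝔭) : absoluteGaloisGroup K))⁻¹ *
              γ ^ (p ^ c * z.appr t)) by group, hPeval G _ 1 _ hh₀, hf] at h
        exact h
      have h2 : conjH1 (kerD κ 𝔭) (W.geomPrimaryTorsion p) d₂ f = f :=
        ht d₂ ⟨(p : ℤ_[p]) ^ c * w, by rw [hd₂]; ring⟩
      calc conjH1 (kerD κ 𝔭) (W.geomPrimaryTorsion p) d f
          = conjH1 (kerD κ 𝔭) (W.geomPrimaryTorsion p) (d₂ * (d₂⁻¹ * d)) f := by
            rw [mul_inv_cancel_left]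
        _ = f := by rw [conjH1_mul_holds (kerD κ 𝔭), AddMonoidHom.comp_apply, h1, h2]
    -- procyclic descent on `D_v`: `f = res z`
    obtain ⟨z, hz⟩ :=
      ProcyclicDescent.exists_resSubgroup_eq_of_forall_conjH1_eq hA (kappaD κ 𝔭) htor f hfix
    -- Poitou–Tate surgery at the base: the finite set `T` of places (no away place to prescribe)
    have hp0 : p ≠ 0 := hpr.ne_zero
    have hbadfin : (W.badPlaces (𝓞 K)).Finite := W.finite_badPlaces_holds (𝓞 K)
    let T : Finset (Place K) := (Finset.univ.image Sum.inl) ∪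
      (((finite_setOf_natCast_mem (K := K) p hp0).toFinset ∪ hbadfin.toFinset).image Sum.inr)
    have hinf : ∀ w : InfinitePlace K, (Sum.inl w : Place K) ∈ T := fun w ↦
      Finset.mem_union_left _ (Finset.mem_image_of_mem _ (Finset.mem_univ w))
    have hpT : ∀ w : HeightOneSpectrum (𝓞 K), ((p : ℕ) : 𝓞 K) ∈ w.asIdeal →
        (Sum.inr w : Place K) ∈ T := fun w hw ↦
      Finset.mem_union_right _ (Finset.mem_image_of_mem _
        (Finset.mem_union_left _ ((Set.Finite.mem_toFinset _).mpr hw)))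
    have hbad : ∀ w : HeightOneSpectrum (𝓞 K), ¬ W.HasGoodReductionAt w →
        (Sum.inr w : Place K) ∈ T := fun w hw ↦
      Finset.mem_union_right _ (Finset.mem_image_of_mem _
        (Finset.mem_union_right _ ((Set.Finite.mem_toFinset _).mpr hw)))
    have hSig : ∀ w ∈ (∅ : Set (HeightOneSpectrum (𝓞 K))), (Sum.inr w : Place K) ∈ T :=
      fun w hw ↦ (Set.notMem_empty w hw).elim
    have hSp : ∀ w ∈ (∅ : Set (HeightOneSpectrum (𝓞 K))), ((p : ℕ) : 𝓞 K) ∉ w.asIdeal :=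
      fun w hw ↦ (Set.notMem_empty w hw).elim
    have hRfin : {w : HeightOneSpectrum (𝓞 K) | (Sum.inr w : Place K) ∈ T ∧
        ((p : ℕ) : 𝓞 K) ∉ w.asIdeal}.Finite :=
      (T.finite_toSet.preimage Sum.inr_injective.injOn).subset fun w hw ↦ hw.1
    have hfinR := finite_relaxed W p (𝔮 := 𝔮) hEP hfin hRfin (fun w hw ↦ hw.2)
    -- the local family: `infl z` at `𝔭` (the only prescribed place)
    let zfam : ∀ w : HeightOneSpectrum (𝓞 K), subgroupH1 (decomp (K := K) w) (W.geomPrimaryTorsion p) :=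
      fun w ↦ if h : w = 𝔭 then
        cast (congrArg (fun x : HeightOneSpectrum (𝓞 K) ↦
          subgroupH1 (decomp (K := K) x) (W.geomPrimaryTorsion p)) h.symm) z else 0
    have hzv : zfam 𝔭 = z := (dif_pos rfl).trans (cast_eq _ _)
    let τ : ∀ w : (insert 𝔭 (∅ : Set (HeightOneSpectrum (𝓞 K))) : Set (HeightOneSpectrum (𝓞 K))),
        galoisCohomology
          ((primaryGaloisModule W p).toLocal (Sum.inr (w : HeightOneSpectrum (𝓞 K)))) 1 :=
      fun w ↦ inflDecomp hM (w : HeightOneSpectrum (𝓞 K)) (zfam w)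
    have hτv : ∀ hv' : 𝔭 ∈ insert 𝔭 (∅ : Set (HeightOneSpectrum (𝓞 K))),
        τ ⟨𝔭, hv'⟩ = inflDecomp hM 𝔭 z := fun hv' ↦ by
      change inflDecomp hM 𝔭 (zfam 𝔭) = _
      rw [hzv]
    obtain ⟨K₀, hK₀⟩ := exists_pow_nsmul_family_eq_zero ((Set.finite_empty).insert 𝔭) τ
    obtain ⟨N, xN, hxN, hloc⟩ := SchneiderFreeAdditiveX3.levelLiftingP_of_finite_anyTorsion W p 𝔭 ∅ T hPT
      (fun w ↦ IsTotallyComplex.isComplex w) h𝔭 h𝔮 hne hSp hinf hpT hSig hbad hfinR htor𝔮 K₀ τ hK₀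
    obtain ⟨s₀, hs₀⟩ : ∃ s₀ : W.subgroupH1 p H, s₀ = ResKernel.resSubgroup H (W.geomPrimaryTorsion p)
        (toDiscreteH1 hM (galoisCohomology.map (Levels.primaryInclusion W p N) 1 xN)) := ⟨_, rfl⟩
    have hconj : ∀ σ : absoluteGaloisGroup K, W.conjH1 p H σ s₀ = s₀ := fun σ ↦ by
      rw [hs₀]; exact conjH1_resSubgroup H σ _
    -- the local values of `s₀`: `f` at `𝔭`, `0` at every place away from `p`
    have hlv := hloc ⟨𝔭, Set.mem_insert _ _⟩
    rw [hτv] at hlv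
    have hresv : resKerD κ (W.geomPrimaryTorsion p) 𝔭 s₀ = f := by
      rw [hs₀, resKerD_resSubgroup, resSubgroup_decomp_eq_of_localization_eq hM 𝔭
        (galoisCohomology.map (Levels.primaryInclusion W p N) 1 xN) z hlv, hz]
    have hres0 : ∀ w : HeightOneSpectrum (𝓞 K), ((p : ℕ) : 𝓞 K) ∉ w.asIdeal →
        resKerD κ (W.geomPrimaryTorsion p) w s₀ = 0 := by
      intro w hpw
      rw [hs₀, resKerD_resSubgroup, resSubgroup_decomp_eq_zero_of_localization_eq_zero hM w
        (galoisCohomology.map (Levels.primaryInclusion W p N) 1 xN)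
        (localization_map_primaryInclusion_eq_zero_of_mem_upperStructureP W p N 𝔭 ∅ hxN h𝔭 hpw
          (Set.notMem_empty w)), map_zero]
    -- `s₀ ∈ G_rel^Σ = selmerAc W p κ v₀ Σ` (away-trivial EVERYWHERE off `p`; nothing to check above `p`)
    have hs₀Sel : s₀ ∈ selmerAc W p κ v₀ S := by
      change s₀ ∈ selmerOver H (W.geomPrimaryTorsion p) p v₀ S
      rw [mem_selmerOver_iff_awayKer]
      refine ⟨fun w hpw _ σ ↦ ?_, fun w σ ↦ ?_, fun σ ↦ ?_⟩
      · rw [hconj, mem_awayKer_iff_resKerD_eq_zero]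
        exact hres0 w hpw
      · exact mem_infKer_of_decompInf_eq_bot w
          (decompInf_eq_bot_of_isComplex (IsTotallyComplex.isComplex w)) _
      · rw [hconj, mem_awayKer_iff_resKerD_eq_zero]
        exact hres0 v₀ hv₀
    refine ⟨⟨s₀, hs₀Sel⟩, Subtype.ext (funext fun σ ↦ ?_)⟩
    rw [hΦapply]
    change resKerD κ (W.geomPrimaryTorsion p) 𝔭 (W.conjH1 p H σ s₀) = G.1 σ
    rw [hconj, hresv]
    obtain ⟨d, n, h, -, hh, rfl⟩ := exists_decomp_mul_pow_lt_mul_mem_ker κ hγ 𝔭 hc σ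
    rw [hPeval G d (γ ^ n) h hh, hpow, hfix]
  -- the engine
  have hsurj := surjective_of_comm_of_surjective_of_ker_le Φ
    (conjSelmerAc W p κ v₀ S γ - 1) ψ hcomm hφ hker hnil
  obtain ⟨s, hs⟩ := hsurj ⟨F, hFH, hFD⟩
  exact ⟨s, s.2, fun σ ↦ by rw [← hΦapply, hs]⟩


/-! ### The route's instance -/

/-- **`G_rel^Σ(K_∞, E_K[p^∞]) ↠ ⊕_{w∣𝔭} H¹(K_{∞,w}, E_K[p^∞])` for `E/ℚ` over an imaginary quadratic `K` with `p` split**, ANY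
`ℤ_p`-extension `κ` with topological generator `γ` in which `𝔭 ∣ p` is finitely decomposed, ANY `Σ` with a fake strict place
`v₀ ∤ p`, `v₀ ∉ Σ`, from Poitou–Tate ×2 and `Sel_v(K, E[p^∞]) < ∞` at both `v ∣ p` — NO (iv) (`H²(K, E[p^∞]) = 0` by
`subsingleton_galoisCohomology_two_primary_anyTorsion`, killing exponent at the conjugate prime by
`exists_pow_nsmul_fixedPoints_decomp_eq_zero`). [cite: GreenbergVatsal2000, §2 Prop. (2.1) (pp. 23–24)]
[cite: JetchevSkinnerWan2017, Prop. 3.3.2 and Lemma 3.3.3 (arXiv:1512.06894 pp. 11–12)] [cite: MilneADT2006, Ch. I, Thm. 4.10] -/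
theorem exists_mem_selmerAc_relaxed_forall_resKerD_strictPlace_eq_baseChange_anyTorsion
    (W : WeierstrassCurve ℚ) [W.IsElliptic] [W.IsGloballyMinimal] (p : ℕ) [Fact p.Prime]
    {K : Type} [Field K] [NumberField K]
    (hPT : poitouTate_selmerStructure_duality K) (hPT2 : poitouTate_sha_tateDual K)
    (hK : IsImaginaryQuadratic K) (hsplit : SplitsIn K p)
    (κ : ZpExtension K p) {γ : absoluteGaloisGroup K} (hγ : κ.IsTopGenerator γ)
    {𝔭 : HeightOneSpectrum (𝓞 K)} (h𝔭 : ((p : ℕ) : 𝓞 K) ∈ 𝔭.asIdeal) (hv : ¬ (decomp 𝔭 ≤ κ.kerSubgroup))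
    (hfin : ∀ v : HeightOneSpectrum (𝓞 K), ((p : ℕ) : 𝓞 K) ∈ v.asIdeal →
      Finite (selmerAcBase (W.baseChange K) p v ∅))
    (S : Set (HeightOneSpectrum (𝓞 K))) {v₀ : HeightOneSpectrum (𝓞 K)} (hv₀ : ((p : ℕ) : 𝓞 K) ∉ v₀.asIdeal)
    (hv₀S : v₀ ∉ S)
    (F : absoluteGaloisGroup K → subgroupH1 (kerD κ 𝔭) ((W.baseChange K).geomPrimaryTorsion p))
    (hFH : ∀ (σ h : absoluteGaloisGroup K), h ∈ κ.kerSubgroup → F (σ * h) = F σ)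
    (hFD : ∀ (d : decomp (K := K) 𝔭) (σ : absoluteGaloisGroup K),
      F ((d : absoluteGaloisGroup K) * σ) =
        conjH1 (kerD κ 𝔭) ((W.baseChange K).geomPrimaryTorsion p) d (F σ)) :
    ∃ s ∈ selmerAc (W.baseChange K) p κ v₀ S, ∀ σ : absoluteGaloisGroup K,
      resKerD κ ((W.baseChange K).geomPrimaryTorsion p) 𝔭 ((W.baseChange K).conjH1 p κ.kerSubgroup σ s) = F σ := by
  haveI : IsTotallyComplex K := hK.2
  haveI hEK : (W.baseChange K).IsElliptic := by rw [WeierstrassCurve.baseChange]; infer_instance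
  obtain ⟨σ, 𝔮, -, hne, h𝔮, -⟩ :=
    LocalIndexTransport.exists_conj_prime_of_splitsIn K p hK.1 hsplit h𝔭
  have htor := exists_pow_nsmul_local_eq_zero W p hK.1 hsplit
  haveI := hfin 𝔭 h𝔭
  have h2 := SchneiderFreeAdditiveX3.subsingleton_galoisCohomology_two_primary_anyTorsion (W.baseChange K) p 𝔭 ∅
    hPT2 (fieldCdLE_two_of_isTotallyComplex fieldCdLE_two_of_numberField_holds K p) htor
  obtain ⟨he𝔮, hf𝔮⟩ := degreeOne_of_splitsIn hK.1 hsplit h𝔮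
  obtain ⟨m, hm⟩ := SchneiderFreeAdditiveX3.exists_pow_nsmul_fixedPoints_decomp_eq_zero W p 𝔮 h𝔮 he𝔮 hf𝔮
  exact exists_mem_selmerAc_relaxed_forall_resKerD_strictPlace_eq_anyTorsion (W.baseChange K) p κ hPT
    (fun v ↦ GaloisImage.EP.localEulerPoincareCharacteristic_adicCompletion K v) h𝔭 h𝔮 hne hm
    (hfin 𝔮 h𝔮) h2 hγ S hv₀ hv₀S hv F hFH hFD

end Summit.BirchSwinnertonDyer.BirchSwinnertonDyer.Theorems.UniversalToricDescentSigmaLocalImage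

end
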